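import Summits.AtomisticToContinuum.Crystallization.Theorems.ExcessDecayLiouvilleStepTheta
import Summits.AtomisticToContinuum.Crystallization.Theorems.ExcessDecayLiouvilleStepEnergyBound
import Summits.AtomisticToContinuum.Crystallization.Theorems.ExcessDecayLiouvilleVerticalDifferences
import Summits.AtomisticToContinuum.Crystallization.Theorems.ExcessDecayLiouvilleDiscreteSobolev1D
import Summits.AtomisticToContinuum.Crystallization.Theorems.ExcessDecayLiouvilleLatticeCoordinates

/-!
# Route `ExcessDecayLiouville`: the induction step, part B — the inputs of the linear step (nonlinear half, XXVII)

Harmonic-replacement architecture for item `ExcessDecay` (stmt-AtomisticToContinuum-9334), nonlinear half.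
For `h = v + w` (step field `v` with its cubic envelope, sharp mass, crude bound, support radius and gradient
currencies; correction `w` with `Σ'‖w‖² ≤ W`, `nnForm w ≤ E_w`): the mass `𝐌[h, R_M] ≤ 2 M_sh + 2W`, the far
mass `𝐉[h, Y]`, the gradient far masses `𝐉[Δ_τ h, Y]` for the three lattice vectors, and the values of `h`
near the centre (`step_h_currencies`).
All `[folklore]`; helper lemmas, nothing here closes an item.
-/

noncomputable section

namespace Summit.AtomisticToContinuum.Crystallization.Theorems.ExcessDecayLiouville

open scoped BigOperators Topology InnerProductSpace RealInnerProductSpace Classical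
open Literature.MathematicalPhysics.StatisticalMechanics
open Summit.AtomisticToContinuum.Crystallization.Theorems.PhononStabilityNegative

set_option quotPrecheck false in
-- Local notation: ball indicator.
local notation "𝟙ᵇ[" x ", " c ", " R "]" => (if dist (x : EuclideanSpace ℝ (Fin 3)) c ≤ R then (1 : ℝ) else 0)

section

variable {t : Fin 2 → EuclideanSpace ℝ (Fin 3)} {A : EuclideanSpace ℝ (Fin 3) →L[ℝ] EuclideanSpace ℝ (Fin 3)}
  {c₀ : EuclideanSpace ℝ (Fin 3)}

variable (hA : Adm₀ A) (hI : Inner₀ t A)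

set_option quotPrecheck false in
-- Local notation: the finite near-neighbour form on the ball of radius `X` about `c₀`.
local notation "NN[" v ", " X "]" =>
  (∑ p ∈ (finite_sites_dist_le (t := t) (A := A) hA hI c₀ X).toFinset,
    ∑ q ∈ (finite_sites_dist_le (t := t) (A := A) hA hI c₀ X).toFinset,
      (if p ≠ q ∧ dist p q ≤ 11 / 10 then ‖v p - v q‖ ^ 2 else (0 : ℝ)))
set_option quotPrecheck false in
-- local mass on the ball of radius `X` about `c₀`
local notation "𝐌[" f ", " X "]" =>
  tsum (fun p : Sites₀ t A => ‖f (p : EuclideanSpace ℝ (Fin 3))‖ ^ 2 * 𝟙ᵇ[p, c₀, X])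
set_option quotPrecheck false in
-- weighted far mass with floor `Y` about `c₀`
local notation "𝐉[" f ", " Y "]" =>
  tsum (fun q : Sites₀ t A => ‖f (q : EuclideanSpace ℝ (Fin 3))‖ ^ 2 * (max (dist (q : EuclideanSpace ℝ (Fin 3)) c₀) Y)⁻¹ ^ 8)

/-- `‖A w₃‖ ≤ 2` for an admissible cell (`‖w₃‖ ≤ 2` by the motif decomposition). [folklore] -/
theorem norm_Aw₃_le_two (hA : Adm₀ A) : ‖A (layerNormal (2 * Real.sqrt (2 / 3)))‖ ≤ 2 := by
  have h1 : ‖(layerNormal (2 * Real.sqrt (2 / 3)) : EuclideanSpace ℝ (Fin 3))‖ ≤ 2 := by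
    have e : (layerNormal (2 * Real.sqrt (2 / 3)) : EuclideanSpace ℝ (Fin 3)) =
        (layerNormal (2 * Real.sqrt (2 / 3)) - (barlowOffset 1 + layerNormal (Real.sqrt (2 / 3)))) +
          (barlowOffset 1 + layerNormal (Real.sqrt (2 / 3))) := by abel
    rw [e]
    refine (norm_add_le _ _).trans ?_
    rw [norm_layerNormal_two_sub_motif, norm_motif]; norm_num
  calc ‖A (layerNormal (2 * Real.sqrt (2 / 3)))‖ ≤ 199 / 200 * ‖(layerNormal (2 * Real.sqrt (2 / 3)) : EuclideanSpace ℝ (Fin 3))‖ :=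
        norm_apply_le_of_adm₀ hA _
    _ ≤ 2 := by linarith

include hA hI in
/-- **Induction step, part B: the inputs of the linear step** (see the module docstring). [folklore] -/
theorem step_h_currencies (v w : (EuclideanSpace ℝ (Fin 3)) → (EuclideanSpace ℝ (Fin 3)))
    (hv : (Function.support v).Finite) (hw : (Function.support w).Finite)
    {r C ρ Dv Msh W Ew q₁ q₂ q₃ q₄ q₅ Ntot : ℝ} (hr : 192 ≤ r) (hC : 0 ≤ C) (hρ : 64 ≤ ρ) (hρr : 8 * ρ ≤ r)
    (hq₁ : 0 ≤ q₁) (hq₂ : 0 ≤ q₂) (hq₃ : 0 ≤ q₃) (hq₄ : 0 ≤ q₄) (hq₅ : 0 ≤ q₅) (hN : 0 ≤ Ntot) (hEw : 0 ≤ Ew)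
    (henv : ∀ x ∈ Sites₀ t A, dist x c₀ ≤ r / 4 → ‖v x‖ ^ 2 ≤ C * (max (dist x c₀) ρ) ^ 3)
    (hvD : ∀ x, ‖v x‖ ≤ Dv)
    (hsupp : ∀ x ∈ Sites₀ t A, 7 * r / 8 < dist x c₀ → v x = 0) (hsupp' : ∀ x, v x ≠ 0 → x ∈ Sites₀ t A)
    {RM : ℝ} (hMsh : 𝐌[v, RM] ≤ Msh)
    (hnear : ∀ a, ρ ≤ a → 32 * a ≤ r → NN[v, a] ≤ q₁ * a + q₂ * a ^ 2 + q₃ * a ^ 3 + q₄ * a ^ 4 + q₅ * a ^ 5)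
    (hfar : ∀ a, NN[v, a] ≤ Ntot)
    (hW : ∑' q : Sites₀ t A, ‖w q‖ ^ 2 ≤ W) (hE : nnForm t A w ≤ Ew)
    {Y : ℝ} (hY : ρ ≤ Y) :
    𝐌[(fun x => v x + w x), RM] ≤ 2 * Msh + 2 * W ∧
    𝐉[(fun x => v x + w x), Y] ≤ 2 * (4096 * C / Y ^ 2 + 8192 * (7 * r / 8) ^ 3 * Dv ^ 2 / ((r / 4) ^ 7 * Y)) + 2 * Y⁻¹ ^ 8 * W ∧
    (𝐉[(fun x => (fun y => v y + w y) (x + A (triangularVec₁ 1)) - (fun y => v y + w y) x), Y] +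
      𝐉[(fun x => (fun y => v y + w y) (x + A (triangularVec₂ 1)) - (fun y => v y + w y) x), Y] +
      𝐉[(fun x => (fun y => v y + w y) (x + A (layerNormal (2 * Real.sqrt (2 / 3)))) - (fun y => v y + w y) x), Y] ≤
      6 * (2 * ((2 * (4 * q₁ * Y + 4 ^ 2 * q₂ * Y ^ 2 + 4 ^ 3 * q₃ * Y ^ 3 + 4 ^ 4 * q₄ * Y ^ 4 + 4 ^ 5 * q₅ * Y ^ 5) / Y ^ 8 +
        256 * Ntot / ((r / 64) ^ 7 * Y))) + 2 * Y⁻¹ ^ 8 * Ew)) ∧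
    (∀ x ∈ Sites₀ t A, dist x c₀ ≤ 11 / 5 → ‖v x + w x‖ ≤ Real.sqrt (C * ρ ^ 3) + Real.sqrt W) := by
  have hY1 : 1 ≤ Y := by linarith
  have hY3 : 3 ≤ Y := by linarith
  have hY0 : 0 < Y := by linarith
  have hRs : (1 : ℝ) ≤ 7 * r / 8 := by linarith
  have hRe : (0 : ℝ) < r / 4 := by linarith
  refine ⟨?_, ?_, ?_, ?_⟩
  · exact (mass_add_le (t := t) (A := A) (c₀ := c₀) hv hw RM).trans (add_le_add (mul_le_mul_of_nonneg_left hMsh (by norm_num))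
      (mul_le_mul_of_nonneg_left hW (by norm_num)))
  · exact farMass_h_le hA hI v w hv hw hC hRs hRe henv hvD hsupp hsupp' hY1 hY hW
  · -- the three lattice vectors
    have hsuppv : ∀ x, v x ≠ 0 → dist x c₀ ≤ 7 * r / 8 := by
      intro x hx
      by_contra h
      exact hx (hsupp x (hsupp' x hx) (lt_of_not_ge h))
    have hnear' : ∀ a, Y ≤ a → 32 * a ≤ r → NN[v, a] ≤ q₁ * a + q₂ * a ^ 2 + q₃ * a ^ 3 + q₄ * a ^ 4 + q₅ * a ^ 5 :=
      fun a ha har => hnear a (hY.trans ha) har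
    obtain ⟨hu1, hu2⟩ := norm_apply_triangularVec_le hA
    have hne1 : A (triangularVec₁ 1) ≠ 0 := by
      intro h
      obtain ⟨hi, -, -⟩ := abs_coord_le_norm_apply_latticeVec hA 1 0 0
      simp only [Int.cast_one, one_smul, Int.cast_zero, zero_smul, add_zero, abs_one] at hi
      rw [h, norm_zero, mul_zero] at hi
      linarith
    have hne2 : A (triangularVec₂ 1) ≠ 0 := by
      intro h
      obtain ⟨-, hj, -⟩ := abs_coord_le_norm_apply_latticeVec hA 0 1 0
      simp only [Int.cast_one, one_smul, Int.cast_zero, zero_smul, add_zero, zero_add, abs_one] at hj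
      rw [h, norm_zero, mul_zero] at hj
      linarith
    -- ball inequalities
    have hball1 : ∀ R : ℝ, ∑ q ∈ (finite_sites_dist_le (t := t) (A := A) hA hI c₀ R).toFinset,
        ‖v (q + A (triangularVec₁ 1)) - v q‖ ^ 2 ≤ 1 * NN[v, R + 3] := fun R => by
      rw [one_mul]
      exact (sum_translate_sq_le_NN hA hI v R triangularVec₁_mem_Λ₀ hne1 hu1).trans (NN_mono hA hI v (by linarith))
    have hball2 : ∀ R : ℝ, ∑ q ∈ (finite_sites_dist_le (t := t) (A := A) hA hI c₀ R).toFinset,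
        ‖v (q + A (triangularVec₂ 1)) - v q‖ ^ 2 ≤ 1 * NN[v, R + 3] := fun R => by
      rw [one_mul]
      exact (sum_translate_sq_le_NN hA hI v R triangularVec₂_mem_Λ₀ hne2 hu2).trans (NN_mono hA hI v (by linarith))
    have hball3 : ∀ R : ℝ, ∑ q ∈ (finite_sites_dist_le (t := t) (A := A) hA hI c₀ R).toFinset,
        ‖v (q + A (layerNormal (2 * Real.sqrt (2 / 3)))) - v q‖ ^ 2 ≤ 4 * NN[v, R + 3] := fun R =>
      sum_vertical_sq_le_NN hA hI v R
    -- the corrections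
    have hΔw1 : ∑' q : Sites₀ t A, ‖(fun x => w (x + A (triangularVec₁ 1)) - w x) q‖ ^ 2 ≤ 1 * Ew := by
      rw [one_mul]; exact (tsum_diff_sq_le_nnForm hA hI hw triangularVec₁_mem_Λ₀ hu1).trans hE
    have hΔw2 : ∑' q : Sites₀ t A, ‖(fun x => w (x + A (triangularVec₂ 1)) - w x) q‖ ^ 2 ≤ 1 * Ew := by
      rw [one_mul]; exact (tsum_diff_sq_le_nnForm hA hI hw triangularVec₂_mem_Λ₀ hu2).trans hE
    have hΔw3 : ∑' q : Sites₀ t A, ‖(fun x => w (x + A (layerNormal (2 * Real.sqrt (2 / 3)))) - w x) q‖ ^ 2 ≤ 4 * Ew :=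
      (tsum_vdiff_sq_le_nnForm hA hI hw).trans (mul_le_mul_of_nonneg_left hE (by norm_num))
    have h1 := farMassDiff_h_le hA hI v w hv hw (triangularVec₁ 1) (by norm_num : (0 : ℝ) ≤ 1) hY3 hr hq₁ hq₂ hq₃ hq₄ hq₅ hN
      hball1 hnear' hfar hsuppv (hu1.trans (by norm_num)) hΔw1
    have h2 := farMassDiff_h_le hA hI v w hv hw (triangularVec₂ 1) (by norm_num : (0 : ℝ) ≤ 1) hY3 hr hq₁ hq₂ hq₃ hq₄ hq₅ hN
      hball2 hnear' hfar hsuppv (hu2.trans (by norm_num)) hΔw2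
    have h3 := farMassDiff_h_le hA hI v w hv hw (layerNormal (2 * Real.sqrt (2 / 3))) (by norm_num : (0 : ℝ) ≤ 4) hY3 hr
      hq₁ hq₂ hq₃ hq₄ hq₅ hN hball3 hnear' hfar hsuppv (norm_Aw₃_le_two hA) hΔw3
    have hP0 : 0 ≤ 2 * ((2 * (4 * q₁ * Y + 4 ^ 2 * q₂ * Y ^ 2 + 4 ^ 3 * q₃ * Y ^ 3 + 4 ^ 4 * q₄ * Y ^ 4 + 4 ^ 5 * q₅ * Y ^ 5) / Y ^ 8 +
        256 * Ntot / ((r / 64) ^ 7 * Y))) := by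
      have : 0 < r / 64 := by linarith
      positivity
    have hE0 : 0 ≤ 2 * Y⁻¹ ^ 8 * Ew := by positivity
    nlinarith [h1, h2, h3, hP0, hE0]
  · -- values near the centre
    intro x hx hxd
    have hsumw : Summable (fun q : Sites₀ t A => ‖w q‖ ^ 2) := by
      have := summable_normSq_mul_of_finite (t := t) (A := A) hw (fun _ => (1 : ℝ))
      simpa using this
    have hwx : ‖w x‖ ^ 2 ≤ W := by
      have h := hsumw.le_tsum ⟨x, hx⟩ (fun q _ => by positivity)
      exact h.trans hW
    have hvx : ‖v x‖ ^ 2 ≤ C * ρ ^ 3 := by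
      refine (henv x hx (by linarith)).trans ?_
      rw [max_eq_right (by linarith)]
    calc ‖v x + w x‖ ≤ ‖v x‖ + ‖w x‖ := norm_add_le _ _
      _ ≤ Real.sqrt (C * ρ ^ 3) + Real.sqrt W :=
          add_le_add (Real.le_sqrt_of_sq_le hvx) (Real.le_sqrt_of_sq_le hwx)

end

end Summit.AtomisticToContinuum.Crystallization.Theorems.ExcessDecayLiouville

end
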